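import Summits.QuantumFields.YangMills.Theorems.ForcedResponseSkewnessRunningCouplingCeilingSmearToolkit
import Summits.QuantumFields.YangMills.Theorems.BalabanLadderNTCanonicalEnvelopes
import HarnessLib

/-!
# Crux `RunningCouplingCeiling` (repaired: stmt-QuantumFields-24275), line `pointwise-log-ceiling`: preparation for the
# smearing step UNIFORM over `L¹`-normalised sources in a fixed positive-time ball

Support file (`--supports stmt-QuantumFields-24275`) by the width prover `ym-line-frs-p3` of route `ForcedResponseSkewness`
(lead `ym-line-frs-p1`).  The planner's repair (route rev 2, 2026-08-28) restated the crux with `HasCompactSupport` data and a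
constant `C` UNIFORM over all real Schwartz `v` with `tsupport v ⊆ closedBall p ρ₀` (`ρ₀ < p₀`) and `∫|v| ≤ 1`, the thresholds
`β₆, Λ₆` being chosen after `v`.  This file collects the v-independent ingredients of the matching analysis half of the line
(the theorem `uniform_smear` itself is in `…RunningCouplingCeilingUniformSmear`):

* `exists_latticeSum_abs_le` — for a Schwartz `v` supported in `closedBall 0 R` there is `s₀ > 0` with
  `s⁴ Σ_{x ∈ box L} |v(s x)| ≤ ∫|v| + 1` for all `0 < s ≤ s₀` and all boxes covering the support (`R ≤ s·L`)
  (the tree's Riemann-sum convergence `NT.CeilingPrice.tendsto_envelope`, read at `β = 1/s`);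
* `log_sq_le_four_mul_log_sq_inv` — the logarithmic window `log²Λ ≤ 4 log²(1/q)` for `q ≤ 2R/Λ`, `Λ ≥ 4R²`;
* `pair_coords`, `pair_torusDist` — a pair charged by `θv ⊗ v` (support in `closedBall p ρ₀`) has time coordinates
  `−s x₀, s y₀ ∈ [p₀−ρ₀, p₀+ρ₀]`, so NO wall flatness is needed: its torus distance obeys `2(p₀−ρ₀) ≤ d·s ≤ 2R` (no periodic
  wrap-around once `2R ≤ s·L`; uses the lead's `abs_sub_le_torusDist`, `torusDist_le_norm_sub`);
* `kernel_mul_log_sq_le` — on such a pair a kernel with the scale-free clause `d⁸|K| ≤ C₁` and the running-coupling clause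
  `t d ≤ ½ → d⁸|K| ≤ C₀/log²(1/(t d))` has `|K| log²Λ ≤ s⁸ (4C₀⁺ + C₁⁺ log²(4R²))/(2δ)⁸` (running-coupling clause for
  `Λ ≥ 4R²`, where `log(1/(t d)) ≥ ½ log Λ`; scale-free clause for `2 ≤ Λ < 4R²`).

Honest label: bookkeeping/analysis for a CONDITIONAL rung line (leaf R2a `BalabanLadder.NT`, itself one binder of the spine);
the physics half (pointwise kernel bounds for the torus covariance of the action densities) is untouched here; nothing in this
file bears on the Yang–Mills mass gap, which is NOT proved by any of this.
-/

set_option autoImplicit false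

noncomputable section

namespace Summit.QuantumFields.YangMills.Cruxes.RunningCouplingCeiling.Pointwise

open Set Metric Filter Topology Finset MeasureTheory
open scoped SchwartzMap
open Literature.MathematicalPhysics.QuantumLattice Literature.Probability.LatticeModels
open Summit.QuantumFields.YangMills.Cruxes.NT.CeilingPrice (tendsto_envelope sum_box_eq_sum_box_of_cover
  tsupport_abs_subset integral_abs_thetaTest)
open Summit.QuantumFields.YangMills.Cruxes.NT.Reference (tsupport_thetaTest_subset_closedBall_zero)

/-! ### Lattice `ℓ¹`-sums of a compactly supported witness are eventually below `‖v‖₁ + 1` -/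

/-- **Riemann bound for the lattice `ℓ¹`-sum.**  For a Schwartz `v` supported in `closedBall 0 R` there is `s₀ > 0` such
that `s⁴ Σ_{x ∈ box L} |v(s x)| ≤ ∫|v| + 1` for all `0 < s ≤ s₀` and all boxes with `R ≤ s·L` (the sum does not depend on
such `L`, and as `s → 0⁺` it tends to `∫|v|`). [folklore] -/
theorem exists_latticeSum_abs_le (v : 𝓢(EuclideanSpace ℝ (Fin 4), ℝ)) {R : ℝ}
    (hv : tsupport (v : EuclideanSpace ℝ (Fin 4) → ℝ) ⊆ closedBall 0 R) :
    ∃ s₀ : ℝ, 0 < s₀ ∧ ∀ s : ℝ, 0 < s → s ≤ s₀ → ∀ L : ℕ, R ≤ s * L →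
      s ^ 4 * ∑ x ∈ box 4 L, |v (s • siteToE x)| ≤ (∫ y, |v y|) + 1 := by
  -- unit map `a β = 1 / max β 1 → 0⁺` and covering boxes `⌈R · max β 1⌉₊`
  set a : ℝ → ℝ := fun β => 1 / max β 1 with ha_def
  set Lb : ℝ → ℕ := fun β => ⌈R * max β 1⌉₊ with hLb_def
  have hm : ∀ β : ℝ, 0 < max β 1 := fun β => lt_of_lt_of_le one_pos (le_max_right β 1)
  have ha : ∀ β, 0 < a β := fun β => by rw [ha_def]; exact div_pos one_pos (hm β)
  have ha0 : Tendsto a atTop (𝓝 0) := by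
    have h1 : Tendsto (fun β : ℝ => max β 1) atTop atTop :=
      tendsto_atTop_mono (fun β => le_max_left β 1) tendsto_id
    have h2 := h1.inv_tendsto_atTop
    refine h2.congr fun β => ?_
    simp [ha_def]
  have hL : ∀ᶠ β in atTop, R ≤ a β * Lb β := by
    refine Eventually.of_forall fun β => ?_
    have h1 : R * max β 1 ≤ (Lb β : ℝ) := Nat.le_ceil _
    rw [ha_def]
    have h2 : R = 1 / max β 1 * (R * max β 1) := by field_simp
    rw [h2]
    exact mul_le_mul_of_nonneg_left h1 (ha β).le
  have key := tendsto_envelope v hv a Lb ha ha0 hL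
  have hev : ∀ᶠ β in atTop, a β ^ 4 * ∑ x ∈ box 4 (Lb β), |v (a β • siteToE x)| ≤ (∫ y, |v y|) + 1 :=
    key.eventually (Iic_mem_nhds (lt_add_one _))
  obtain ⟨β₁, hβ₁⟩ := eventually_atTop.1 hev
  refine ⟨1 / max β₁ 1, div_pos one_pos (hm β₁), fun s hs hs₀ L hRL => ?_⟩
  -- read the eventual bound at `β = 1/s`
  have hβ : max β₁ 1 ≤ 1 / s := by
    rw [le_div_iff₀ hs]
    rw [le_div_iff₀ (hm β₁)] at hs₀
    linarith
  have h1s : (1 : ℝ) ≤ 1 / s := le_trans (le_max_right _ _) hβ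
  have haβ : a (1 / s) = s := by
    rw [ha_def]
    simp only [max_eq_left h1s, one_div_one_div]
  have hmain := hβ₁ (1 / s) (le_trans (le_max_left _ _) hβ)
  rw [haβ] at hmain
  -- both boxes cover the support, so the sums agree
  have hcov : R ≤ s * (Lb (1 / s) : ℝ) := by
    have h1 : R * max (1 / s) 1 ≤ (Lb (1 / s) : ℝ) := Nat.le_ceil _
    rw [max_eq_left h1s] at h1
    have h2 : R = s * (R * (1 / s)) := by field_simp
    rw [h2]
    exact mul_le_mul_of_nonneg_left h1 hs.le
  have e1 : ∑ x ∈ box 4 (max L (Lb (1 / s))), |v (s • siteToE x)| = ∑ x ∈ box 4 L, |v (s • siteToE x)| :=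
    sum_box_eq_sum_box_of_cover (φ := fun y => |v y|) hs (tsupport_abs_subset hv) hRL (le_max_left _ _)
  have e2 : ∑ x ∈ box 4 (max L (Lb (1 / s))), |v (s • siteToE x)| =
      ∑ x ∈ box 4 (Lb (1 / s)), |v (s • siteToE x)| :=
    sum_box_eq_sum_box_of_cover (φ := fun y => |v y|) hs (tsupport_abs_subset hv) hcov (le_max_right _ _)
  rw [← e1, e2]
  exact hmain


/-! ### Elementary inequalities -/

/-- Division bookkeeping: `D·X ≤ Y` and `E ≤ D·S` give `X ≤ S·Y/E` (`X, Y, S ≥ 0`, `E > 0`). [folklore] -/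
theorem le_mul_div_of_mul_le {D X Y E S : ℝ} (hX : 0 ≤ X) (hS : 0 ≤ S) (hE : 0 < E)
    (h1 : D * X ≤ Y) (h2 : E ≤ D * S) : X ≤ S * Y / E := by
  rw [le_div_iff₀ hE]
  calc X * E ≤ X * (D * S) := mul_le_mul_of_nonneg_left h2 hX
    _ = S * (D * X) := by ring
    _ ≤ S * Y := mul_le_mul_of_nonneg_left h1 hS

/-- **The logarithmic window.**  If `1 ≤ R`, `4R² ≤ Λ` and `0 < q ≤ 2R/Λ` then `log²Λ ≤ 4 log²(1/q)`
(`log(1/q) ≥ log(Λ/(2R)) ≥ ½ log Λ`). [folklore] -/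
theorem log_sq_le_four_mul_log_sq_inv {R Λ q : ℝ} (hR : 1 ≤ R) (hΛ : 4 * R ^ 2 ≤ Λ) (hq : 0 < q)
    (hqΛ : q ≤ 2 * R / Λ) : Real.log Λ ^ 2 ≤ 4 * Real.log (1 / q) ^ 2 := by
  have hR0 : 0 < R := lt_of_lt_of_le one_pos hR
  have hΛ0 : 0 < Λ := lt_of_lt_of_le (by positivity) hΛ
  have hΛ1 : 1 ≤ Λ := le_trans (by nlinarith) hΛ
  -- `log(2R) ≤ ½ log Λ`
  have h2R : 2 * Real.log (2 * R) ≤ Real.log Λ := by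
    have hpow : Real.log ((2 * R) ^ 2) = 2 * Real.log (2 * R) := by
      rw [Real.log_pow]; norm_num
    rw [← hpow]
    refine Real.log_le_log (by positivity) ?_
    nlinarith
  -- `log(1/q) ≥ log(Λ/(2R)) = log Λ − log(2R)`
  have hq1 : Λ / (2 * R) ≤ 1 / q := by
    rw [div_le_div_iff₀ (by positivity) hq]
    rw [le_div_iff₀ hΛ0] at hqΛ
    linarith
  have hlog : Real.log Λ - Real.log (2 * R) ≤ Real.log (1 / q) := by
    rw [← Real.log_div hΛ0.ne' (by positivity)]
    exact Real.log_le_log (by positivity) hq1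
  have hhalf : Real.log Λ / 2 ≤ Real.log (1 / q) := by linarith
  have hnn : 0 ≤ Real.log Λ / 2 := div_nonneg (Real.log_nonneg hΛ1) (by norm_num)
  have hsq := pow_le_pow_left₀ hnn hhalf 2
  nlinarith [hsq]

/-! ### Geometry of a charged pair -/

/-- **Time coordinates and norms of a charged pair.**  If `θv(s x) ≠ 0` and `v(s y) ≠ 0` for a witness supported in
`closedBall p ρ₀`, then `−s x₀, s y₀ ∈ [p₀ − ρ₀, p₀ + ρ₀]` and `‖s x‖, ‖s y‖ ≤ ‖p‖ + ρ₀`. [folklore] -/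
theorem pair_coords {v : 𝓢(EuclideanSpace ℝ (Fin 4), ℝ)} {p : EuclideanSpace ℝ (Fin 4)} {ρ₀ s : ℝ}
    (hv : tsupport (v : EuclideanSpace ℝ (Fin 4) → ℝ) ⊆ closedBall p ρ₀) {x y : Fin 4 → ℤ}
    (hx : thetaTest 4 v (s • siteToE x) ≠ 0) (hy : v (s • siteToE y) ≠ 0) :
    p 0 - ρ₀ ≤ -(s * x 0) ∧ -(s * x 0) ≤ p 0 + ρ₀ ∧ p 0 - ρ₀ ≤ s * y 0 ∧ s * y 0 ≤ p 0 + ρ₀ ∧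
      ‖s • siteToE x‖ ≤ ‖p‖ + ρ₀ ∧ ‖s • siteToE y‖ ≤ ‖p‖ + ρ₀ := by
  -- the charged points lie in the ball
  have key : ∀ w : EuclideanSpace ℝ (Fin 4), v w ≠ 0 →
      p 0 - ρ₀ ≤ w 0 ∧ w 0 ≤ p 0 + ρ₀ ∧ ‖w‖ ≤ ‖p‖ + ρ₀ := by
    intro w hw
    have hmem : w ∈ closedBall p ρ₀ := hv (subset_tsupport _ (Function.mem_support.2 hw))
    rw [mem_closedBall, dist_eq_norm] at hmem
    have h0 : |(w - p) 0| ≤ ρ₀ := by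
      have := PiLp.norm_apply_le (w - p) (0 : Fin 4)
      rw [Real.norm_eq_abs] at this
      exact this.trans hmem
    rw [PiLp.sub_apply, abs_le] at h0
    refine ⟨by linarith [h0.1], by linarith [h0.2], ?_⟩
    have := norm_le_norm_add_norm_sub' w p
    linarith
  rw [thetaTest_apply] at hx
  obtain ⟨hx1, hx2, hx3⟩ := key _ hx
  obtain ⟨hy1, hy2, hy3⟩ := key _ hy
  have hθ0 : timeReflection 4 (s • siteToE x) 0 = -(s * x 0) := by simp
  have hy0 : (s • siteToE y) 0 = s * y 0 := by simp
  rw [hθ0] at hx1 hx2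
  rw [hy0] at hy1 hy2
  rw [LinearIsometryEquiv.norm_map] at hx3
  exact ⟨hx1, hx2, hy1, hy2, hx3, hy3⟩

/-- **Torus distance of a charged pair.**  With `2δ ≤ s(y₀ − x₀)`, `s(y₀ − x₀) ≤ 2R'`, `‖s x‖, ‖s y‖ ≤ R'` and no
wrap-around (`2R' ≤ s·L`), the torus distance `d` satisfies `2δ ≤ d·s` and `d·s ≤ 2R'`. [folklore] -/
theorem pair_torusDist {s δ R' : ℝ} (hs : 0 < s) (hδ : 0 < δ) {L : ℕ} {x y : Fin 4 → ℤ}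
    (hlow : 2 * δ ≤ s * ((y 0 : ℝ) - x 0)) (hup : s * ((y 0 : ℝ) - x 0) ≤ 2 * R')
    (hxR : ‖s • siteToE x‖ ≤ R') (hyR : ‖s • siteToE y‖ ≤ R') (hL : 2 * R' ≤ s * L) :
    2 * δ ≤ torusDist L x y * s ∧ torusDist L x y * s ≤ 2 * R' := by
  have hpos : (0 : ℝ) < (y 0 : ℝ) - x 0 := by
    by_contra h
    rw [not_lt] at h
    nlinarith
  have habs : ((|x 0 - y 0| : ℤ) : ℝ) = (y 0 : ℝ) - x 0 := by
    have h' : x 0 - y 0 < 0 := by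
      have : ((x 0 : ℤ) : ℝ) - y 0 < 0 := by linarith
      exact_mod_cast this
    rw [abs_of_neg h']
    push_cast
    ring
  have hint : |x 0 - y 0| ≤ (L : ℤ) := by
    have h1 : (y 0 : ℝ) - x 0 ≤ L := by
      have h2 : s * ((y 0 : ℝ) - x 0) ≤ s * L := hup.trans hL
      exact le_of_mul_le_mul_left h2 hs
    have h3 : ((|x 0 - y 0| : ℤ) : ℝ) ≤ (L : ℝ) := by rw [habs]; exact h1
    exact_mod_cast h3
  have hd1 := abs_sub_le_torusDist L x y hint
  have hd1' : (y 0 : ℝ) - x 0 ≤ torusDist L x y := by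
    rw [← habs]; exact_mod_cast hd1
  have hd2 := torusDist_le_norm_sub L x y
  have hd3 : s * ‖siteToE x - siteToE y‖ ≤ 2 * R' := by
    calc s * ‖siteToE x - siteToE y‖ = ‖s • siteToE x - s • siteToE y‖ := by
          rw [← smul_sub, norm_smul, Real.norm_of_nonneg hs.le]
      _ ≤ ‖s • siteToE x‖ + ‖s • siteToE y‖ := norm_sub_le _ _
      _ ≤ 2 * R' := by linarith
  constructor
  · calc 2 * δ ≤ s * ((y 0 : ℝ) - x 0) := hlow
      _ ≤ s * torusDist L x y := mul_le_mul_of_nonneg_left hd1' hs.le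
      _ = torusDist L x y * s := mul_comm _ _
  · calc torusDist L x y * s ≤ ‖siteToE x - siteToE y‖ * s := mul_le_mul_of_nonneg_right hd2 hs.le
      _ = s * ‖siteToE x - siteToE y‖ := mul_comm _ _
      _ ≤ 2 * R' := hd3

/-! ### The kernel bound of a charged pair -/

/-- **Kernel size on a charged pair.**  With `2δ ≤ d s ≤ 2R`, `s = l t`, `Λ ≤ l`, the scale-free clause
`d⁸ k ≤ C₁` and the running-coupling clause `t d ≤ ½ → d⁸ k ≤ C₀/log²(1/(t d))` give
`k log²Λ ≤ s⁸ (4C₀⁺ + C₁⁺ log²(4R²))/(2δ)⁸` (running-coupling clause for `Λ ≥ 4R²`, scale-free clause below). [folklore] -/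
theorem kernel_mul_log_sq_le {C₀ C₁ t d s l Λ R δ k : ℝ} (hR1 : 1 ≤ R) (hΛ : 2 ≤ Λ) (hl1 : Λ ≤ l)
    (hs : s = l * t) (ht : 0 < t) (hd0 : 0 < d) (hδ : 0 < δ) (hd1 : 2 * δ ≤ d * s) (hd2 : d * s ≤ 2 * R)
    (hk : 0 ≤ k) (hK1 : d ^ 8 * k ≤ C₁)
    (hK0 : t * d ≤ 1 / 2 → d ^ 8 * k ≤ C₀ / Real.log (1 / (t * d)) ^ 2) :
    k * Real.log Λ ^ 2 ≤ s ^ 8 * ((4 * max C₀ 0 + max C₁ 0 * Real.log (4 * R ^ 2) ^ 2) / (2 * δ) ^ 8) := by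
  have hΛ0 : 0 < Λ := by linarith
  have hlogΛ : 0 < Real.log Λ := Real.log_pos (by linarith)
  have hl0 : 0 < l := by linarith
  have hs0 : 0 < s := by rw [hs]; exact mul_pos hl0 ht
  have hE : (2 * δ) ^ 8 ≤ d ^ 8 * s ^ 8 := by
    rw [← mul_pow]; exact pow_le_pow_left₀ (by positivity) hd1 8
  have hE0 : (0 : ℝ) < (2 * δ) ^ 8 := by positivity
  have hs8 : (0 : ℝ) ≤ s ^ 8 := by positivity
  by_cases hcase : 4 * R ^ 2 ≤ Λ
  · -- running-coupling clause
    have htd : t * d ≤ 2 * R / Λ := by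
      rw [le_div_iff₀ hΛ0]
      calc t * d * Λ ≤ t * d * l := mul_le_mul_of_nonneg_left hl1 (mul_pos ht hd0).le
        _ = d * s := by rw [hs]; ring
        _ ≤ 2 * R := hd2
    have hRR : R ≤ R ^ 2 := by
      calc R = R * 1 := (mul_one R).symm
        _ ≤ R * R := mul_le_mul_of_nonneg_left hR1 (by linarith)
        _ = R ^ 2 := (sq R).symm
    have htd' : t * d ≤ 1 / 2 := by
      refine htd.trans ?_
      rw [div_le_div_iff₀ hΛ0 two_pos]
      linarith
    have h := hK0 htd'
    have hq : 0 < t * d := mul_pos ht hd0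
    have hlogq : 0 < Real.log (1 / (t * d)) := Real.log_pos ((one_lt_div hq).2 (by linarith))
    have hlogq2 : 0 < Real.log (1 / (t * d)) ^ 2 := by positivity
    have hwin := log_sq_le_four_mul_log_sq_inv hR1 hcase hq htd
    have h' : d ^ 8 * k * Real.log (1 / (t * d)) ^ 2 ≤ max C₀ 0 :=
      ((le_div_iff₀ hlogq2).1 h).trans (le_max_left _ _)
    have hdk : 0 ≤ d ^ 8 * k := mul_nonneg (by positivity) hk
    have h'' : d ^ 8 * (k * Real.log Λ ^ 2) ≤ 4 * max C₀ 0 := by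
      calc d ^ 8 * (k * Real.log Λ ^ 2) = (d ^ 8 * k) * Real.log Λ ^ 2 := by ring
        _ ≤ (d ^ 8 * k) * (4 * Real.log (1 / (t * d)) ^ 2) := mul_le_mul_of_nonneg_left hwin hdk
        _ = 4 * (d ^ 8 * k * Real.log (1 / (t * d)) ^ 2) := by ring
        _ ≤ 4 * max C₀ 0 := by linarith
    have h3 := le_mul_div_of_mul_le (mul_nonneg hk (sq_nonneg _)) hs8 hE0 h'' hE
    refine h3.trans ?_
    rw [mul_div_assoc]
    refine mul_le_mul_of_nonneg_left ?_ hs8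
    refine div_le_div_of_nonneg_right ?_ hE0.le
    linarith [mul_nonneg (le_max_right C₁ 0) (sq_nonneg (Real.log (4 * R ^ 2)))]
  · -- scale-free clause
    rw [not_le] at hcase
    have h := hK1.trans (le_max_left C₁ 0)
    have hK' := le_mul_div_of_mul_le hk hs8 hE0 h hE
    have hlogle : Real.log Λ ^ 2 ≤ Real.log (4 * R ^ 2) ^ 2 :=
      pow_le_pow_left₀ hlogΛ.le (Real.log_le_log hΛ0 hcase.le) 2
    have hb0 : 0 ≤ s ^ 8 * max C₁ 0 / (2 * δ) ^ 8 :=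
      div_nonneg (mul_nonneg hs8 (le_max_right _ _)) hE0.le
    calc k * Real.log Λ ^ 2 ≤ (s ^ 8 * max C₁ 0 / (2 * δ) ^ 8) * Real.log (4 * R ^ 2) ^ 2 :=
          mul_le_mul hK' hlogle (sq_nonneg _) hb0
      _ = s ^ 8 * (max C₁ 0 * Real.log (4 * R ^ 2) ^ 2 / (2 * δ) ^ 8) := by ring
      _ ≤ s ^ 8 * ((4 * max C₀ 0 + max C₁ 0 * Real.log (4 * R ^ 2) ^ 2) / (2 * δ) ^ 8) := by
          refine mul_le_mul_of_nonneg_left ?_ hs8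
          refine div_le_div_of_nonneg_right ?_ hE0.le
          linarith [le_max_right C₀ 0]

end Summit.QuantumFields.YangMills.Cruxes.RunningCouplingCeiling.Pointwise

end
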